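import Summits.RiemannHypothesis.RiemannHypothesis.Theorems.JensenPolynomialsSkewFarNormalized

/-!
# Route `JensenPolynomials`, FAR crux `XiCumulantSkew98Far` — part 4: solving the Stein system
(RH-FREE; cell rh-jensen, HUMAN RULING D-0040)

With `s ≥ 4·10¹⁸`, `a = a_s`, `Z = M_s`, `x_n := I_n/Z` (`I_n = ∫ Φu^s(u−a)^n`), the scale `l := a/√s` (so `I_{2n} ≤ (2n−1)‼ l^{2n} Z`,
part 1) and the master numeric fact `a³/√s ≤ 10⁻⁶` (`cube_div_sqrt_le`, from `s ≥ a(4πe^{4a} − 9.005)` and `a ≥ 9.45`),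
the four error-equations of parts 3a/3b collapse to

  `|R x₂ − 1| ≤ 10⁻⁵`, `|R x₁ + κ| ≤ 0.0051`, `|R² x₄ − 3| ≤ 10⁻³`, `|R² x₃ + 5κ| ≤ 0.02`,  `κ = c/R ∈ [1.94, 2]`

(`solve`): the first two moments of `u − a_s` under `ν_s` to `10⁻⁵`, the third and fourth to `2·10⁻²`, uniformly in `s`.
WHAT THIS IS NOT: nothing here bears on the zeros of `ζ`. References: Stein's method (folklore); [CoffeyCsordas2013]; [GORZPNAS2019].
-/

noncomputable section
-- D-0017: `Summit.RiemannHypothesis.RiemannHypothesis.…` duplicates the namespace BY DESIGN (single-problem summit).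
set_option linter.dupNamespace false

namespace Summit.RiemannHypothesis.RiemannHypothesis.Theorems.JensenPolynomials.SkewFar

open Literature.NumberTheory.LFunctions Literature.Probability.Distributions MeasureTheory Set Filter Real
open scoped Topology Nat

/-- Solved system, part (i): `|R x₂ − 1| ≤ 10⁻⁵` and `|R x₁ + κ| ≤ 0.0051`. -/
theorem solve_one (s : ℕ) (hs : 4 * 10 ^ 18 ≤ s) {A R c : ℝ} (hA : A = 4 * π * exp (4 * xiMode (s : ℝ)))
    (hR : R = 4 * A + s / xiMode (s : ℝ) ^ 2) (hc : c = 8 * A - s / xiMode (s : ℝ) ^ 3) {x₁ x₂ x₃ x₄ : ℝ}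
    (hx₁ : x₁ = (∫ u in Ioi 0, deBruijnPhi u * u ^ s * (u - xiMode (s : ℝ))) / xiMoment s)
    (hx₂ : x₂ = xiAbsMoment s 2 (xiMode (s : ℝ)) / xiMoment s)
    (hx₃ : x₃ = (∫ u in Ioi 0, deBruijnPhi u * u ^ s * (u - xiMode (s : ℝ)) ^ 3) / xiMoment s)
    (hx₄ : x₄ = xiAbsMoment s 4 (xiMode (s : ℝ)) / xiMoment s) :
    |R * x₂ - 1| ≤ 1e-5 ∧ |R * x₁ + c / R| ≤ 0.0051 := by
  obtain ⟨ha0, ha, _, _⟩ := mode_facts s hs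
  obtain ⟨hApos, _, _, hR0, hc0, _, _, _⟩ := consts_facts s hs hA hR hc
  obtain ⟨hl0, _, hmu2, hmu, hlb⟩ := scale_facts s hs (l := xiMode (s : ℝ) / Real.sqrt s) rfl
  obtain ⟨hRle, hcle, hCle, hκ1, hκ2⟩ := const_sizes s hs hA hR hc (l := xiMode (s : ℝ) / Real.sqrt s) rfl
  obtain ⟨hl2b, hl3b, hmul1, hmul2, hmul3, hm22, hm23, hm24, hl22, hmul4, hm25⟩ :=
    monomials s hs (l := xiMode (s : ℝ) / Real.sqrt s) rfl
  obtain ⟨⟨hz10, hz20, hz30, hz40, hz50⟩, hz1, hz2, hz3, hz4, hz5⟩ :=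
    z_bounds s hs (l := xiMode (s : ℝ) / Real.sqrt s) rfl hx₂ hx₄ rfl rfl rfl
  obtain ⟨d0, d1, d2, d3, d4, d5⟩ := normalized_system s hs hA hR hc (C := 15 * A + 2 * s / xiMode (s : ℝ) ^ 4) rfl
    hl0 hx₁ hx₃ (x₅ := _) rfl hx₂ hx₄ (z₃ := _) rfl (z₄ := _) rfl (z₅ := _) rfl
  set a := xiMode (s : ℝ) with ha_def
  set l : ℝ := a / Real.sqrt s with hl
  set C : ℝ := 15 * A + 2 * s / a ^ 4 with hC
  set z₃ := xiAbsMoment s 6 a / xiMoment s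
  set z₄ := xiAbsMoment s 8 a / xiMoment s
  set z₅ := xiAbsMoment s 10 a / xiMoment s
  set x₅ := (∫ u in Ioi 0, deBruijnPhi u * u ^ s * (u - a) ^ 5) / xiMoment s
  have hC0 : 0 ≤ C := by positivity
  have hal0 : 0 ≤ a * l := by positivity
  have hal2 : 0 < a / l ^ 2 := by positivity
  -- (1) `y₂ = R x₂`
  have hcx3 : |c * x₃| ≤ 16.44 * (a * l) := by
    rw [abs_mul, abs_of_pos hc0]
    have h1 : |x₃| ≤ (l * l ^ 2 + 3 * l ^ 4 / l) / 2 := d4.trans (by gcongr)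
    have e : 8.22 * (a / l ^ 2) * ((l * l ^ 2 + 3 * l ^ 4 / l) / 2) = 16.44 * (a * l) := by
      field_simp; ring
    calc c * |x₃| ≤ 8.22 * (a / l ^ 2) * ((l * l ^ 2 + 3 * l ^ 4 / l) / 2) :=
          mul_le_mul hcle h1 (abs_nonneg _) (by positivity)
      _ = 16.44 * (a * l) := e
  have hB1 : 1 / 200 / 2 * (l + x₂ / l) + C * x₄ + 5 * 10 ^ 8 * x₄ + 10 ^ 8 * R * z₃ +
      10 ^ 8 * c / 2 * (l * z₃ + z₄ / l) ≤ 1e-7 := by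
    have h1 : 1 / 200 / 2 * (l + x₂ / l) + C * x₄ + 5 * 10 ^ 8 * x₄ + 10 ^ 8 * R * z₃ +
        10 ^ 8 * c / 2 * (l * z₃ + z₄ / l) ≤
        1 / 200 / 2 * (l + l ^ 2 / l) + 15.01 * (a / l ^ 2) * (3 * l ^ 4) + 5 * 10 ^ 8 * (3 * l ^ 4) +
        10 ^ 8 * (4.11 * (a / l ^ 2)) * (15 * l ^ 6) +
        10 ^ 8 * (8.22 * (a / l ^ 2)) / 2 * (l * (15 * l ^ 6) + 105 * l ^ 8 / l) := by
      gcongr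
    have e : 1 / 200 / 2 * (l + l ^ 2 / l) + 15.01 * (a / l ^ 2) * (3 * l ^ 4) + 5 * 10 ^ 8 * (3 * l ^ 4) +
        10 ^ 8 * (4.11 * (a / l ^ 2)) * (15 * l ^ 6) +
        10 ^ 8 * (8.22 * (a / l ^ 2)) / 2 * (l * (15 * l ^ 6) + 105 * l ^ 8 / l) =
        1 / 200 * l + 45.03 * (a * l * l) + 15 * 10 ^ 8 * (l ^ 2 * l ^ 2) + 61.65 * 10 ^ 8 * (a * l * l ^ 3) +
        493.2 * 10 ^ 8 * (a * l * l ^ 3 * l) := by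
      field_simp; ring
    rw [e] at h1
    linarith
  have hy2 : |R * x₂ - 1| ≤ 1e-5 := by
    have e : R * x₂ - 1 = -(1 - R * x₂ - c * x₃) - c * x₃ := by ring
    rw [e]
    calc |-(1 - R * x₂ - c * x₃) - c * x₃| ≤ |-(1 - R * x₂ - c * x₃)| + |c * x₃| := abs_sub _ _
      _ ≤ 1e-7 + 16.44 * (a * l) := by rw [abs_neg]; exact add_le_add (d1.trans hB1) hcx3
      _ ≤ 1e-5 := by linarith
  -- (2) `y₁ = R x₁`
  have hB0 : 1 / 200 + C / 2 * (l * x₂ + x₄ / l) + 10 ^ 8 / 2 * (l * (3 * x₂) + 5 * x₄ / l) +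
      10 ^ 8 * R / 2 * (l * x₄ + z₃ / l) + 10 ^ 8 * c * z₃ ≤ 1 / 200 + 4e-6 := by
    have h1 : 1 / 200 + C / 2 * (l * x₂ + x₄ / l) + 10 ^ 8 / 2 * (l * (3 * x₂) + 5 * x₄ / l) +
        10 ^ 8 * R / 2 * (l * x₄ + z₃ / l) + 10 ^ 8 * c * z₃ ≤
        1 / 200 + 15.01 * (a / l ^ 2) / 2 * (l * l ^ 2 + 3 * l ^ 4 / l) +
        10 ^ 8 / 2 * (l * (3 * l ^ 2) + 5 * (3 * l ^ 4) / l) +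
        10 ^ 8 * (4.11 * (a / l ^ 2)) / 2 * (l * (3 * l ^ 4) + 15 * l ^ 6 / l) +
        10 ^ 8 * (8.22 * (a / l ^ 2)) * (15 * l ^ 6) := by
      gcongr
    have e : 1 / 200 + 15.01 * (a / l ^ 2) / 2 * (l * l ^ 2 + 3 * l ^ 4 / l) +
        10 ^ 8 / 2 * (l * (3 * l ^ 2) + 5 * (3 * l ^ 4) / l) +
        10 ^ 8 * (4.11 * (a / l ^ 2)) / 2 * (l * (3 * l ^ 4) + 15 * l ^ 6 / l) +
        10 ^ 8 * (8.22 * (a / l ^ 2)) * (15 * l ^ 6) =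
        1 / 200 + 30.02 * (a * l) + 9 * 10 ^ 8 * l ^ 3 + 36.99 * 10 ^ 8 * (a * l * l ^ 2) +
        123.3 * 10 ^ 8 * (a * l * l ^ 3) := by
      field_simp; ring
    rw [e] at h1
    linarith
  have hy1 : |R * x₁ + c / R| ≤ 0.0051 := by
    have e : R * x₁ + c / R = (R * x₁ + c * x₂) - c / R * (R * x₂ - 1) := by field_simp; ring
    rw [e]
    calc |R * x₁ + c * x₂ - c / R * (R * x₂ - 1)| ≤ |R * x₁ + c * x₂| + |c / R * (R * x₂ - 1)| := abs_sub _ _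
      _ ≤ (1 / 200 + 4e-6) + 2 * 1e-5 := by
          refine add_le_add (d0.trans hB0) ?_
          rw [abs_mul, abs_of_pos (div_pos hc0 hR0)]
          exact mul_le_mul hκ2 hy2 (abs_nonneg _) (by norm_num)
      _ ≤ 0.0051 := by norm_num
  exact ⟨hy2, hy1⟩

/-- Solved system, part (ii): `|R² x₄ − 3| ≤ 10⁻³`. -/
theorem solve_two (s : ℕ) (hs : 4 * 10 ^ 18 ≤ s) {A R c : ℝ} (hA : A = 4 * π * exp (4 * xiMode (s : ℝ)))
    (hR : R = 4 * A + s / xiMode (s : ℝ) ^ 2) (hc : c = 8 * A - s / xiMode (s : ℝ) ^ 3) {x₁ x₂ x₃ x₄ : ℝ}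
    (hx₁ : x₁ = (∫ u in Ioi 0, deBruijnPhi u * u ^ s * (u - xiMode (s : ℝ))) / xiMoment s)
    (hx₂ : x₂ = xiAbsMoment s 2 (xiMode (s : ℝ)) / xiMoment s)
    (hx₃ : x₃ = (∫ u in Ioi 0, deBruijnPhi u * u ^ s * (u - xiMode (s : ℝ)) ^ 3) / xiMoment s)
    (hx₄ : x₄ = xiAbsMoment s 4 (xiMode (s : ℝ)) / xiMoment s) :
    |R ^ 2 * x₄ - 3| ≤ 1e-3 := by
  obtain ⟨ha0, ha, _, _⟩ := mode_facts s hs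
  obtain ⟨hApos, _, _, hR0, hc0, _, _, _⟩ := consts_facts s hs hA hR hc
  obtain ⟨hl0, _, hmu2, hmu, hlb⟩ := scale_facts s hs (l := xiMode (s : ℝ) / Real.sqrt s) rfl
  obtain ⟨hRle, hcle, hCle, hκ1, hκ2⟩ := const_sizes s hs hA hR hc (l := xiMode (s : ℝ) / Real.sqrt s) rfl
  obtain ⟨hl2b, hl3b, hmul1, hmul2, hmul3, hm22, hm23, hm24, hl22, hmul4, hm25⟩ :=
    monomials s hs (l := xiMode (s : ℝ) / Real.sqrt s) rfl
  obtain ⟨⟨hz10, hz20, hz30, hz40, hz50⟩, hz1, hz2, hz3, hz4, hz5⟩ :=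
    z_bounds s hs (l := xiMode (s : ℝ) / Real.sqrt s) rfl hx₂ hx₄ rfl rfl rfl
  obtain ⟨d0, d1, d2, d3, d4, d5⟩ := normalized_system s hs hA hR hc (C := 15 * A + 2 * s / xiMode (s : ℝ) ^ 4) rfl
    hl0 hx₁ hx₃ (x₅ := _) rfl hx₂ hx₄ (z₃ := _) rfl (z₄ := _) rfl (z₅ := _) rfl
  set a := xiMode (s : ℝ) with ha_def
  set l : ℝ := a / Real.sqrt s with hl
  set C : ℝ := 15 * A + 2 * s / a ^ 4 with hC
  set z₃ := xiAbsMoment s 6 a / xiMoment s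
  set z₄ := xiAbsMoment s 8 a / xiMoment s
  set z₅ := xiAbsMoment s 10 a / xiMoment s
  set x₅ := (∫ u in Ioi 0, deBruijnPhi u * u ^ s * (u - a) ^ 5) / xiMoment s
  have hC0 : 0 ≤ C := by positivity
  have hal0 : 0 ≤ a * l := by positivity
  have hal2 : 0 < a / l ^ 2 := by positivity
  obtain ⟨hy2, _⟩ := solve_one s hs hA hR hc hx₁ hx₂ hx₃ hx₄
  -- (3) `y₄ = R² x₄`
  have hcRx5 : c * R * |x₅| ≤ 3.1e-4 := by
    have h1 : |x₅| ≤ (l * (3 * l ^ 4) + 15 * l ^ 6 / l) / 2 := d5.trans (by gcongr)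
    have h2 : c * R ≤ 8.22 * (a / l ^ 2) * (4.11 * (a / l ^ 2)) := mul_le_mul hcle hRle hR0.le (by positivity)
    have e : 8.22 * (a / l ^ 2) * (4.11 * (a / l ^ 2)) * ((l * (3 * l ^ 4) + 15 * l ^ 6 / l) / 2) =
        304.0578 * (a ^ 2 * l) := by field_simp; ring
    calc c * R * |x₅| ≤ 8.22 * (a / l ^ 2) * (4.11 * (a / l ^ 2)) * ((l * (3 * l ^ 4) + 15 * l ^ 6 / l) / 2) :=
          mul_le_mul h2 h1 (abs_nonneg _) (by positivity)
      _ = 304.0578 * (a ^ 2 * l) := e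
      _ ≤ 3.1e-4 := by linarith
  have hRB3 : R * (1 / 200 / 2 * (l * x₂ + x₄ / l) + C * z₃ + 7 * 10 ^ 8 * z₃ + 10 ^ 8 * R * z₄ +
      10 ^ 8 * c / 2 * (l * z₄ + z₅ / l)) ≤ 1e-7 := by
    have h1 : R * (1 / 200 / 2 * (l * x₂ + x₄ / l) + C * z₃ + 7 * 10 ^ 8 * z₃ + 10 ^ 8 * R * z₄ +
        10 ^ 8 * c / 2 * (l * z₄ + z₅ / l)) ≤
        (4.11 * (a / l ^ 2)) * (1 / 200 / 2 * (l * l ^ 2 + 3 * l ^ 4 / l) + 15.01 * (a / l ^ 2) * (15 * l ^ 6) +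
        7 * 10 ^ 8 * (15 * l ^ 6) + 10 ^ 8 * (4.11 * (a / l ^ 2)) * (105 * l ^ 8) +
        10 ^ 8 * (8.22 * (a / l ^ 2)) / 2 * (l * (105 * l ^ 8) + 945 * l ^ 10 / l)) := by
      gcongr
    have e : (4.11 * (a / l ^ 2)) * (1 / 200 / 2 * (l * l ^ 2 + 3 * l ^ 4 / l) + 15.01 * (a / l ^ 2) * (15 * l ^ 6) +
        7 * 10 ^ 8 * (15 * l ^ 6) + 10 ^ 8 * (4.11 * (a / l ^ 2)) * (105 * l ^ 8) +
        10 ^ 8 * (8.22 * (a / l ^ 2)) / 2 * (l * (105 * l ^ 8) + 945 * l ^ 10 / l)) =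
        0.0411 * (a * l) + 925.3665 * (a ^ 2 * l * l) + 431.55 * 10 ^ 8 * (a * l * l ^ 3) +
        1773.6705 * 10 ^ 8 * (a ^ 2 * l * l ^ 3) + 17736.705 * 10 ^ 8 * (a ^ 2 * l * l ^ 3 * l) := by
      field_simp; ring
    rw [e] at h1
    linarith
  have hy4 : |R ^ 2 * x₄ - 3| ≤ 1e-3 := by
    have hmul : |R * (3 * x₂ - R * x₄ - c * x₅)| ≤ 1e-7 := by
      rw [abs_mul, abs_of_pos hR0]
      exact (mul_le_mul_of_nonneg_left d3 hR0.le).trans hRB3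
    have e : R ^ 2 * x₄ - 3 = -(R * (3 * x₂ - R * x₄ - c * x₅)) + 3 * (R * x₂ - 1) - c * R * x₅ := by ring
    rw [e]
    have t1 : |-(R * (3 * x₂ - R * x₄ - c * x₅))| ≤ 1e-7 := by rw [abs_neg]; exact hmul
    have t2 : |3 * (R * x₂ - 1)| ≤ 3 * 1e-5 := by
      rw [abs_mul, abs_of_pos (by norm_num : (0 : ℝ) < 3)]; linarith
    have t3 : |c * R * x₅| ≤ 3.1e-4 := by rw [abs_mul, abs_of_pos (mul_pos hc0 hR0)]; exact hcRx5
    calc |-(R * (3 * x₂ - R * x₄ - c * x₅)) + 3 * (R * x₂ - 1) - c * R * x₅|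
        ≤ |-(R * (3 * x₂ - R * x₄ - c * x₅)) + 3 * (R * x₂ - 1)| + |c * R * x₅| := abs_sub _ _
      _ ≤ |-(R * (3 * x₂ - R * x₄ - c * x₅))| + |3 * (R * x₂ - 1)| + |c * R * x₅| := by
          gcongr; exact abs_add_le _ _
      _ ≤ 1e-7 + 3 * 1e-5 + 3.1e-4 := by linarith
      _ ≤ 1e-3 := by norm_num
  exact hy4

/-- **The solved Stein system.** For `s ≥ 4·10¹⁸`, `a = a_s`, `A = 4πe^{4a}`, `R = 4A + s/a²`, `c = 8A − s/a³`, `κ = c/R`,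
and the normalised moments `x₁ = I₁/Z`, `x₂ = I₂/Z`, `x₃ = I₃/Z`, `x₄ = I₄/Z` of `u − a` under `ν_s`:
`|R x₂ − 1| ≤ 10⁻⁵`, `|R x₁ + κ| ≤ 0.0051`, `|R²x₄ − 3| ≤ 10⁻³`, `|R²x₃ + 5κ| ≤ 0.02`, and `1.94 ≤ κ ≤ 2`. -/
theorem solve (s : ℕ) (hs : 4 * 10 ^ 18 ≤ s) {A R c : ℝ} (hA : A = 4 * π * exp (4 * xiMode (s : ℝ)))
    (hR : R = 4 * A + s / xiMode (s : ℝ) ^ 2) (hc : c = 8 * A - s / xiMode (s : ℝ) ^ 3) {x₁ x₂ x₃ x₄ : ℝ}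
    (hx₁ : x₁ = (∫ u in Ioi 0, deBruijnPhi u * u ^ s * (u - xiMode (s : ℝ))) / xiMoment s)
    (hx₂ : x₂ = xiAbsMoment s 2 (xiMode (s : ℝ)) / xiMoment s)
    (hx₃ : x₃ = (∫ u in Ioi 0, deBruijnPhi u * u ^ s * (u - xiMode (s : ℝ)) ^ 3) / xiMoment s)
    (hx₄ : x₄ = xiAbsMoment s 4 (xiMode (s : ℝ)) / xiMoment s) :
    |R * x₂ - 1| ≤ 1e-5 ∧ |R * x₁ + c / R| ≤ 0.0051 ∧ |R ^ 2 * x₄ - 3| ≤ 1e-3 ∧ |R ^ 2 * x₃ + 5 * (c / R)| ≤ 0.02 ∧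
      1.94 ≤ c / R ∧ c / R ≤ 2 := by
  obtain ⟨ha0, ha, _, _⟩ := mode_facts s hs
  obtain ⟨hApos, _, _, hR0, hc0, _, _, _⟩ := consts_facts s hs hA hR hc
  obtain ⟨hl0, _, hmu2, hmu, hlb⟩ := scale_facts s hs (l := xiMode (s : ℝ) / Real.sqrt s) rfl
  obtain ⟨hRle, hcle, hCle, hκ1, hκ2⟩ := const_sizes s hs hA hR hc (l := xiMode (s : ℝ) / Real.sqrt s) rfl
  obtain ⟨hl2b, hl3b, hmul1, hmul2, hmul3, hm22, hm23, hm24, hl22, hmul4, hm25⟩ :=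
    monomials s hs (l := xiMode (s : ℝ) / Real.sqrt s) rfl
  obtain ⟨⟨hz10, hz20, hz30, hz40, hz50⟩, hz1, hz2, hz3, hz4, hz5⟩ :=
    z_bounds s hs (l := xiMode (s : ℝ) / Real.sqrt s) rfl hx₂ hx₄ rfl rfl rfl
  obtain ⟨d0, d1, d2, d3, d4, d5⟩ := normalized_system s hs hA hR hc (C := 15 * A + 2 * s / xiMode (s : ℝ) ^ 4) rfl
    hl0 hx₁ hx₃ (x₅ := _) rfl hx₂ hx₄ (z₃ := _) rfl (z₄ := _) rfl (z₅ := _) rfl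
  set a := xiMode (s : ℝ) with ha_def
  set l : ℝ := a / Real.sqrt s with hl
  set C : ℝ := 15 * A + 2 * s / a ^ 4 with hC
  set z₃ := xiAbsMoment s 6 a / xiMoment s
  set z₄ := xiAbsMoment s 8 a / xiMoment s
  set z₅ := xiAbsMoment s 10 a / xiMoment s
  set x₅ := (∫ u in Ioi 0, deBruijnPhi u * u ^ s * (u - a) ^ 5) / xiMoment s
  have hC0 : 0 ≤ C := by positivity
  have hal0 : 0 ≤ a * l := by positivity
  have hal2 : 0 < a / l ^ 2 := by positivity
  obtain ⟨hy2, hy1⟩ := solve_one s hs hA hR hc hx₁ hx₂ hx₃ hx₄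
  have hy4 := solve_two s hs hA hR hc hx₁ hx₂ hx₃ hx₄
  -- (4) `y₃ = R² x₃`
  have hRB2 : R * (1 / 200 * x₂ + C / 2 * (l * x₄ + z₃ / l) + 10 ^ 8 / 2 * (l * (5 * x₄) + 7 * z₃ / l) +
      10 ^ 8 * R / 2 * (l * z₃ + z₄ / l) + 10 ^ 8 * c * z₄) ≤ 1 / 200 * (R * x₂) + 6e-4 := by
    have h1 : R * (C / 2 * (l * x₄ + z₃ / l) + 10 ^ 8 / 2 * (l * (5 * x₄) + 7 * z₃ / l) +
        10 ^ 8 * R / 2 * (l * z₃ + z₄ / l) + 10 ^ 8 * c * z₄) ≤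
        (4.11 * (a / l ^ 2)) * (15.01 * (a / l ^ 2) / 2 * (l * (3 * l ^ 4) + 15 * l ^ 6 / l) +
        10 ^ 8 / 2 * (l * (5 * (3 * l ^ 4)) + 7 * (15 * l ^ 6) / l) +
        10 ^ 8 * (4.11 * (a / l ^ 2)) / 2 * (l * (15 * l ^ 6) + 105 * l ^ 8 / l) +
        10 ^ 8 * (8.22 * (a / l ^ 2)) * (105 * l ^ 8)) := by
      gcongr
    have e : (4.11 * (a / l ^ 2)) * (15.01 * (a / l ^ 2) / 2 * (l * (3 * l ^ 4) + 15 * l ^ 6 / l) +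
        10 ^ 8 / 2 * (l * (5 * (3 * l ^ 4)) + 7 * (15 * l ^ 6) / l) +
        10 ^ 8 * (4.11 * (a / l ^ 2)) / 2 * (l * (15 * l ^ 6) + 105 * l ^ 8 / l) +
        10 ^ 8 * (8.22 * (a / l ^ 2)) * (105 * l ^ 8)) =
        555.21990 * (a ^ 2 * l) + 246.6 * 10 ^ 8 * (a * l * l ^ 2) + 1013.526 * 10 ^ 8 * (a ^ 2 * l * l ^ 2) +
        3547.341 * 10 ^ 8 * (a ^ 2 * l * l ^ 3) := by
      field_simp; ring
    rw [e] at h1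
    have e2 : R * (1 / 200 * x₂ + C / 2 * (l * x₄ + z₃ / l) + 10 ^ 8 / 2 * (l * (5 * x₄) + 7 * z₃ / l) +
        10 ^ 8 * R / 2 * (l * z₃ + z₄ / l) + 10 ^ 8 * c * z₄) = 1 / 200 * (R * x₂) +
        R * (C / 2 * (l * x₄ + z₃ / l) + 10 ^ 8 / 2 * (l * (5 * x₄) + 7 * z₃ / l) +
        10 ^ 8 * R / 2 * (l * z₃ + z₄ / l) + 10 ^ 8 * c * z₄) := by ring
    rw [e2]
    linarith
  have hy3 : |R ^ 2 * x₃ + 5 * (c / R)| ≤ 0.02 := by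
    have hmul : |R * (2 * x₁ - R * x₃ - c * x₄)| ≤ 1 / 200 * (R * x₂) + 6e-4 := by
      rw [abs_mul, abs_of_pos hR0]
      exact (mul_le_mul_of_nonneg_left d2 hR0.le).trans hRB2
    have hRz1 : R * x₂ ≤ 1 + 1e-5 := by have := abs_le.1 hy2; linarith
    have e : R ^ 2 * x₃ + 5 * (c / R) =
        -(R * (2 * x₁ - R * x₃ - c * x₄)) + 2 * (R * x₁ + c / R) - c / R * (R ^ 2 * x₄ - 3) := by
      field_simp; ring
    rw [e]
    have t1 : |-(R * (2 * x₁ - R * x₃ - c * x₄))| ≤ 1 / 200 * (R * x₂) + 6e-4 := by rw [abs_neg]; exact hmul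
    have t2 : |2 * (R * x₁ + c / R)| ≤ 2 * 0.0051 := by
      rw [abs_mul, abs_of_pos (by norm_num : (0 : ℝ) < 2)]; linarith
    have t3 : |c / R * (R ^ 2 * x₄ - 3)| ≤ 2 * 1e-3 := by
      rw [abs_mul, abs_of_pos (div_pos hc0 hR0)]
      exact mul_le_mul hκ2 hy4 (abs_nonneg _) (by norm_num)
    calc |-(R * (2 * x₁ - R * x₃ - c * x₄)) + 2 * (R * x₁ + c / R) - c / R * (R ^ 2 * x₄ - 3)|
        ≤ |-(R * (2 * x₁ - R * x₃ - c * x₄)) + 2 * (R * x₁ + c / R)| + |c / R * (R ^ 2 * x₄ - 3)| := abs_sub _ _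
      _ ≤ |-(R * (2 * x₁ - R * x₃ - c * x₄))| + |2 * (R * x₁ + c / R)| + |c / R * (R ^ 2 * x₄ - 3)| := by
          gcongr; exact abs_add_le _ _
      _ ≤ (1 / 200 * (R * x₂) + 6e-4) + 2 * 0.0051 + 2 * 1e-3 := by linarith
      _ ≤ 0.02 := by linarith
  exact ⟨hy2, hy1, hy4, hy3, hκ1, hκ2⟩

end Summit.RiemannHypothesis.RiemannHypothesis.Theorems.JensenPolynomials.SkewFar

end
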